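import Summits.QuantumFields.YangMills.Theses.PoincareLipschitz
import Summits.QuantumFields.YangMills.Theorems.PoincareLipschitzStubBoundedBoxConcentration
import Literature.MathematicalPhysics.QuantumFieldTheory.Balaban1983to89.T4AxialGaugeSmallField
import HarnessLib

/-!
# LINE 30 «CurvaturePoincare» — SKELETON v1 (successor of LINE 29 «CombPeierls» on the same item): a REGIME DECOMPOSITION of the MESOSCOPIC RESIDUAL of K1′

Cell `ym3-torus` (YM ladder rung R3 = continuum SU(2) Yang–Mills on T³ — a RUNG, NOT d = 4, NOT infinite volume, NOT a mass gap, NOT Clay).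
Ideator seat `ym-r3-idea-2` g16, lens «nearmiss».  Crux of record `UnitScaleTilt.HistoryTailL` (stmt-QuantumFields-19936, the seat's write slot); this
line's CONCLUSION BY NAME is `PoincareLipschitz.MesoscopicConcentrationL` (stmt-QuantumFields-23532, K1′ of route PoincareLipschitz, rank 2).

STATE OF THE ITEM (19:25Z).  The BOUNDED-BOX half `n ≤ 17·L³` is a TREE THEOREM — ✓`PoincareLipschitzStubBoundedBoxConcentration.stub_boundedBoxConcentration`
(LEAD ★w1 g8, 04:24Z, from ✓p694602 `LocalInsertion.BoxConcentrationBounded.boxConcentration_bounded`), re-derived by LINE 29's stubs ✓p739489 (P) ·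
✓p739571 (D) · ✓p739715 (B) (19:05–19:11Z) — so 23532 RESTS ON ITS MESOSCOPIC RESIDUAL ALONE (✓px10 `…OfMesoscopicBox.mesoscopicConcentrationL_of_mesoscopicBox`):
boxes `17·L³ < n ≤ β_K`, LINE 23's `stub_mesoscopicBoxConcentration`, XL, organ-adjacent, nobody's claim.  THIS LINE ATTACKS THAT RESIDUAL and cites the
bounded half BY NAME (imported theorem; no CombPeierls stub is repeated).

THE LINE.  (ii) THREE NEW STUBS — `stub_curvaturePinning` (deterministic: a lattice-Uhlenbeck / nonlinear Poincaré lemma, distance-to-pure-gauge on a box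
`≤ C·n·‖curvature‖_{ℓ²(box)}`), `stub_localBoxExpMoment` (LOCAL exponential moment `∫exp(β_K/24·Σ_{box}dist₁²) ≤ e^{E₁n³}` from the chessboard and the landed
partition-function ratio ✓p677025) and `stub_sqrtPinnedTail` (measure bookkeeping) ⟹ the crux's EXACT RATE `exp(−cc·β_K r²/(n²Λ²))` for ALL boxes in the
LARGE-DEVIATION regime `β_K·r² ≥ C_th·Λ²·n⁵` (kernel `largeDeviation_of`, sorry-free); (iii) the residual `stub_moderateDeviationResidual` = the crux
restricted to `17·L³ < n ≤ β_K` AND `β_K·r² ≤ C_th·Λ²·n⁵` (the Gaussian-concentration window — organ-adjacent, NOT claimed) ⟹ with (ii) LINE 23's residual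
statement verbatim (kernel `mesoscopicResidual_of`), and with the tree's bounded half the crux BY NAME (§3).

THE NEAR-MISS (lens).  LINE 29 reaches the crux only on bounded boxes because its pinning is in SUP norm (`|f − f(𝟙)| ≤ Λ·4n³·max_p dist₁`, one bad
plaquette spoils it) — for `n > 17L³` the union bound over `3(n+1)³` plaquettes cannot produce the rate `β_K r²/n²`.  THE SINGLE INPUT TO IMPROVE: pin in
`ℓ²` instead of `ℓ^∞` — `|f − f(𝟙)| ≤ Λ·C·n·(Σ_{p∈box} dist₁(U(∂p))²)^{1/2}` (box Poincaré constant `n`, not `n³`; scale-invariant and saturated by smooth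
rescaled continuum connections) — and replace the single-plaquette tail by the LOCAL exponential moment of the box action.  Exponential Chebyshev then gives
`μ_K{r ≤ f − ∫f} ≤ e^{E₁n³}·exp(−β_K r²/(96·Λ²C²n²))`, i.e. the crux's rate as soon as `β_K r² ≳ E₁C²Λ²n⁵`.  MEASURED DEFICIT of this route: the factor
`n³ = n⁵/n²` between its threshold `r ≳ Λ n^{5/2}/√β_K` and the crux's Poincaré scale `r ≳ Λ n/√β_K` — exactly the entropy `e^{E₁ n³}` of the box action,
which only a Gaussian/log-Sobolev mechanism (the residual) removes.

HONEST SCOPE.  No summit, rung, crux or stub is proved here; FOUR sorries, all in `stub_*`.  Stubs are stated over Literature/Theses/Mathlib declarations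
only.  `stub_curvaturePinning` is, as far as searched, NOT in print for nonabelian lattice fields (see its docstring) — it is this line's one genuinely new
lemma; its cheapest falsifier is a 2³–4³-box numerical minimisation (gauge-fix to minimal `Σ_b dist₁(U_b)²` vs `Σ_p dist₁(U(∂p))²`, incl. a thin ℤ₂-vortex loop).

REGISTRATION.  Written to `Cruxes/HistoryTailL/Lines/curvature_poincare.lean` (write slot of 19936); registered `--crux stmt-QuantumFields-23532`, SUPERSEDING
LINE 29 v1.1 on that item (all three of its mechanism stubs are landed theorems; its only open stub, the residual, is split here — nothing in flight is lost).
-/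

open scoped BigOperators
open MeasureTheory
open Literature.MathematicalPhysics.QuantumFieldTheory.Balaban1983to89
open Literature.MathematicalPhysics.QuantumFieldTheory.Balaban1983to89.T3ContinuumYM3Torus
open Literature.MathematicalPhysics.QuantumFieldTheory.Balaban1983to89.T3UnitScaleTilt
open Literature.MathematicalPhysics.QuantumFieldTheory.Balaban1983to89.T3UnitLawDensityEML (ℰp)
open Literature.MathematicalPhysics.QuantumFieldTheory.Balaban1983to89.T4AxialGaugeSmallField (boxPlaqs castSite axialGauge)

namespace Summit.QuantumFields.YangMills.Cruxes.HistoryTailL.CurvaturePoincare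

/-! ## §1 The MESOSCOPIC REGIME SPLIT (lens «nearmiss»): the curvature route reaches the crux's EXACT RATE `β_K r²/(n²Λ²)` for LARGE deviations
`β_K r² ≥ C_th·Λ²·n⁵` from three stubs — a NONLINEAR POINCARÉ (lattice-Uhlenbeck) pinning on boxes, the LOCAL exponential moment of the box action
(chessboard + the landed partition ratio ✓p677025), and √-pinned measure bookkeeping — and leaves the MODERATE-deviation window
`β_K r² ≤ C_th·Λ²·n⁵` at `17L³ < n ≤ β_K` as the residual (the Gaussian-concentration content; MEASURED DEFICIT: the factor `n³ = n⁵/n²` between the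
curvature threshold and the crux's Poincaré scale). -/

open Classical in
/-- **stub_curvaturePinning (M–L, the NEW deterministic input: a lattice Uhlenbeck / nonlinear Poincaré lemma on boxes).**  There is an absolute `C` with:
for every non-wrapping box of side `n` at `x₀` (`1 ≤ n`, `2n ≤ sitesPerDir`) and every gauge-invariant, box-local, `Λ`-Lipschitz `f`,
`|f(U) − f(𝟙)| ≤ Λ·C·n·(Σ_{p ∈ boxPlaqs} dist₁(U(∂p))²)^{1/2}` for EVERY configuration `U`.  CONTENT: `min_g Σ_{b ∈ box} dist₁(U^g_b)² ≤ C²n²·Σ_{p∈box} dist₁(U(∂p))²`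
(distance to pure gauge on a simply connected box ≤ box Poincaré constant `≍ n` × `ℓ²`-curvature), then gauge invariance + box-locality + Lipschitz as in (D).
Linear abelian model: Hodge/Poincaré for 1-forms modulo exact forms on a box, constant `1/√λ₁ ≍ n/π` (sharp: a smooth `O(1)`-curvature continuum
connection rescaled to the box saturates it).  WHY IT MIGHT FAIL: `ℓ²`-small but CONCENTRATED curvature (`Σ dist₁^{3/2} ≳ ε_U`, below the range where the
small-field axial/Landau gauges linearise; the trivial cap `dist ≤ 2√(3(n+1)³)` only covers `‖F‖ ≳ √n`), and ℤ₂-vortex-type holonomy obstructions — the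
global nonabelian lattice statement is, as far as searched, NOT in print (presearch: corpus fts+vec «lattice gauge field distance to pure gauge bounded by
curvature / Coulomb gauge Poincaré / Uhlenbeck», galaxy pdf «lattice Uhlenbeck|discrete Uhlenbeck»: no hits; nearest: K. Uhlenbeck CMP 83 (1982) (continuum,
`‖F‖_{L^{d/2}}` small), Bałaban CMP 99 (1985) Landau-gauge regularity in the SMALL-FIELD regime).  SIZE M–L.  Sources: [Uhlenbeck1982]; [Balaban1985PropagatorsII];
✓`T4AxialGaugeSmallField.dist1_gaugeAct_axialGauge_le_uniform` (the sup-norm small-field version, constant `2n`). -/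
theorem stub_curvaturePinning :
    ∃ C : ℝ, 0 < C ∧ ∀ (F : T3Family) (K n : ℕ) (x₀ : Site (F.P K) 0)
      (f : GaugeField (F.P K) 0 (Matrix.specialUnitaryGroup (Fin 2) ℂ) → ℝ) (Λ : ℝ), 0 ≤ Λ → 1 ≤ n → 2 * n ≤ (F.P K).sitesPerDir 0 →
      GaugeField.GaugeInvariant f →
      (∀ U U' : GaugeField (F.P K) 0 (Matrix.specialUnitaryGroup (Fin 2) ℂ),
        (∀ b : PBond (F.P K) 0, (∀ k, (b.src k - x₀ k).val < n) → (∀ k, (b.tgt k - x₀ k).val < n) → U b = U' b) → f U = f U') →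
      (∀ U U' : GaugeField (F.P K) 0 (Matrix.specialUnitaryGroup (Fin 2) ℂ),
        |f U - f U'| ≤ Λ * Real.sqrt (∑ b : PBond (F.P K) 0, GaugeGroup.dist1 (U b * (U' b)⁻¹) ^ 2)) →
      ∀ U : GaugeField (F.P K) 0 (Matrix.specialUnitaryGroup (Fin 2) ℂ),
        |f U - f (fun _ => 1)| ≤ Λ * (C * (n : ℝ)) * Real.sqrt (∑ p ∈ Finset.univ.filter (fun p : Plaq (F.P K) 0 => p ∈ boxPlaqs (P := F.P K) (j := 0) (fun k => ((x₀ k).val : ℤ)) (fun k => ((x₀ k).val : ℤ) + ((n : ℤ) - 1))), GaugeGroup.dist1 (GaugeField.plaqHol U p) ^ 2) := by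
  sorry

open Classical in
/-- **stub_localBoxExpMoment (S–M, from landed inputs).**  LOCAL exponential moment and mean of the box action at coupling `β_K/24`:
`∫ exp(β_K/24·Σ_{p∈box} dist₁²) dμ_K ≤ e^{E₁n³}` and `∫ Σ_{p∈box} dist₁² dμ_K ≤ E₁n³/β_K`, uniformly in `γ ≤ 1`, `K`, the volume and the box
(plus the trivial measurability / range rows of the box sum).  MECHANISM: Hölder over the three orientations; per orientation the FILS chessboard
(✓`HistoryTailChessboardT3.chessboardRP_T3`) bounds the box product by the full product to the power `#box/|T|`; the full exponential moment at `β_K/8` is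
✓p677025 `CoarseStiffnessTailUniformMeanAction.exists_bareStiffness_le` (`≤ e^{E·#Plaq₀}`, `#Plaq₀ = 3|T|`); the mean from ✓`exists_meanSqSum_le` and
translation invariance, or by Jensen from the moment.  WHY IT MIGHT FAIL: only bookkeeping (chessboard needs a bounded class function of ONE plaquette per
site: `exp(β/8·dist₁²)` is bounded by `e^{β/2}` — fine for RP, the bound enters nowhere).  SIZE S–M.  Sources: [FrohlichIsraelLiebSimon1978] Thm 4.1; ✓p677025; ✓p739489 (pattern). -/
theorem stub_localBoxExpMoment :
    ∀ (L : ℕ), ∃ (E₁ : ℝ), 0 ≤ E₁ ∧ ∃ γ₁ : ℝ, 0 < γ₁ ∧ γ₁ ≤ 1 ∧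
      ∀ (F : T3Family) (γ : ℝ), F.L = L → 0 < γ → γ ≤ γ₁ → ∀ (K n : ℕ) (x₀ : Site (F.P K) 0), 1 ≤ n → 2 * n ≤ (F.P K).sitesPerDir 0 →
        (Measurable fun U : GaugeField (F.P K) 0 (Matrix.specialUnitaryGroup (Fin 2) ℂ) => (∑ p ∈ Finset.univ.filter (fun p : Plaq (F.P K) 0 => p ∈ boxPlaqs (P := F.P K) (j := 0) (fun k => ((x₀ k).val : ℤ)) (fun k => ((x₀ k).val : ℤ) + ((n : ℤ) - 1))), GaugeGroup.dist1 (GaugeField.plaqHol U p) ^ 2)) ∧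
        (∀ U : GaugeField (F.P K) 0 (Matrix.specialUnitaryGroup (Fin 2) ℂ), 0 ≤ (∑ p ∈ Finset.univ.filter (fun p : Plaq (F.P K) 0 => p ∈ boxPlaqs (P := F.P K) (j := 0) (fun k => ((x₀ k).val : ℤ)) (fun k => ((x₀ k).val : ℤ) + ((n : ℤ) - 1))), GaugeGroup.dist1 (GaugeField.plaqHol U p) ^ 2) ∧ (∑ p ∈ Finset.univ.filter (fun p : Plaq (F.P K) 0 => p ∈ boxPlaqs (P := F.P K) (j := 0) (fun k => ((x₀ k).val : ℤ)) (fun k => ((x₀ k).val : ℤ) + ((n : ℤ) - 1))), GaugeGroup.dist1 (GaugeField.plaqHol U p) ^ 2) ≤ 12 * ((n : ℝ) + 1) ^ 3) ∧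
        ∫ U, Real.exp ((F.scheme ℰp γ).β K / 24 * (∑ p ∈ Finset.univ.filter (fun p : Plaq (F.P K) 0 => p ∈ boxPlaqs (P := F.P K) (j := 0) (fun k => ((x₀ k).val : ℤ)) (fun k => ((x₀ k).val : ℤ) + ((n : ℤ) - 1))), GaugeGroup.dist1 (GaugeField.plaqHol U p) ^ 2)) ∂(gibbsK F ℰp γ K) ≤ Real.exp (E₁ * (n : ℝ) ^ 3) ∧
        ∫ U, (∑ p ∈ Finset.univ.filter (fun p : Plaq (F.P K) 0 => p ∈ boxPlaqs (P := F.P K) (j := 0) (fun k => ((x₀ k).val : ℤ)) (fun k => ((x₀ k).val : ℤ) + ((n : ℤ) - 1))), GaugeGroup.dist1 (GaugeField.plaqHol U p) ^ 2) ∂(gibbsK F ℰp γ K) ≤ E₁ * (n : ℝ) ^ 3 / (F.scheme ℰp γ).β K := by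
  sorry

/-- **stub_sqrtPinnedTail (S–M, pure measure theory).**  Under `μ_K = gibbsK` (probability): if measurable `g` is pinned `|g − g₁| ≤ M·√X` to a bounded
measurable `X ≥ 0` with `∫e^{tX} ≤ e^A` and `∫X ≤ m`, then for `r > 0`, `r² ≥ 4M²m`: `μ_K{r ≤ g − ∫g} ≤ e^A·exp(−t·r²/(4M²))`.
MECHANISM: centring `|∫g − g₁| ≤ M∫√X ≤ M√(∫X) ≤ M√m ≤ r/2` (Jensen / Cauchy–Schwarz on a probability space); on the event `M√X ≥ r/2`, i.e.
`X ≥ r²/(4M²)`; exponential Chebyshev (`ProbabilityTheory.measure_ge_le_exp_mul_mgf`).  `M = 0` ⇒ `g ≡ g₁`, event empty.  WHY IT MIGHT FAIL: only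
bookkeeping (integrability from the range rows).  SIZE S–M.  Sources: Mathlib `measure_ge_le_exp_mul_mgf`, `integral_mono`; Ledoux (2001) §1.1. -/
theorem stub_sqrtPinnedTail :
    ∀ (F : T3Family) (γ : ℝ), 0 < γ → ∀ (K : ℕ) (X g : GaugeField (F.P K) 0 (Matrix.specialUnitaryGroup (Fin 2) ℂ) → ℝ) (g₁ M t A m Xmax : ℝ),
      Measurable g → Measurable X → 0 ≤ M → 0 < t → 0 ≤ m → (∀ U, 0 ≤ X U) → (∀ U, X U ≤ Xmax) →
      (∀ U, |g U - g₁| ≤ M * Real.sqrt (X U)) →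
      ∫ U, Real.exp (t * X U) ∂(gibbsK F ℰp γ K) ≤ Real.exp A →
      ∫ U, X U ∂(gibbsK F ℰp γ K) ≤ m →
      ∀ r : ℝ, 0 < r → 4 * (M ^ 2 * m) ≤ r ^ 2 →
        (gibbsK F ℰp γ K).real {U | r ≤ g U - ∫ V, g V ∂(gibbsK F ℰp γ K)} ≤ Real.exp A * Real.exp (-(t * r ^ 2 / (4 * M ^ 2))) := by
  sorry

/-- **stub_moderateDeviationResidual (XL, RESIDUAL — the Gaussian-concentration window, HONESTLY NOT this line's mechanism).**  `MesoscopicConcentrationL`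
restricted to MESOSCOPIC boxes `17·L³ < n ≤ β_K` AND MODERATE deviations `β_K r² ≤ C_th·Λ²·n⁵`, for every threshold `C_th > 0` (constants may depend on
it).  This is where 23532 lives after v2: typical fluctuations are `≍ Λn/√β_K` (box Poincaré constant `n²` in the Gaussian covariance), the curvature route
certifies the rate only from `Λn^{5/2}/√β_K` on.  WHY IT MIGHT FAIL: it is the weak-coupling Gaussian/log-Sobolev content at mesoscopic scale (organ-adjacent).
SIZE XL.  Sources: LINE 23 card; [Ledoux2001] Ch. 5; [BakryEmery1985]. -/
theorem stub_moderateDeviationResidual :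
        open Literature.MathematicalPhysics.QuantumFieldTheory.Balaban1983to89 Literature.MathematicalPhysics.QuantumFieldTheory.Balaban1983to89.T3ContinuumYM3Torus in ∀ (L : ℕ) (Cth : ℝ), 0 < Cth → ∃ (Cc cc : ℝ), 0 ≤ Cc ∧ 0 < cc ∧ ∃ γ₁ : ℝ, 0 < γ₁ ∧ γ₁ ≤ 1 ∧ ∀ (F : T3Family) (γ : ℝ), F.L = L → 0 < γ → γ ≤ γ₁ → ∀ (K n : ℕ), 1 ≤ n → (n : ℝ) ≤ (F.scheme T3UnitLawDensityEML.ℰp γ).β K → 2 * n ≤ (F.P K).sitesPerDir 0 → 17 * L ^ 3 < n → ∀ (x₀ : Site (F.P K) 0) (f : GaugeField (F.P K) 0 (Matrix.specialUnitaryGroup (Fin 2) ℂ) → ℝ) (Λ : ℝ), 0 < Λ → Measurable f → GaugeField.GaugeInvariant f → (∀ U U' : GaugeField (F.P K) 0 (Matrix.specialUnitaryGroup (Fin 2) ℂ), (∀ b : PBond (F.P K) 0, (∀ k, (b.src k - x₀ k).val < n) → (∀ k, (b.tgt k - x₀ k).val < n) → U b = U' b) → f U = f U') → (∀ U U' : GaugeField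 (F.P K) 0 (Matrix.specialUnitaryGroup (Fin 2) ℂ), |f U - f U'| ≤ Λ * Real.sqrt (∑ b : PBond (F.P K) 0, GaugeGroup.dist1 (U b * (U' b)⁻¹) ^ 2)) → ∀ r : ℝ, 0 ≤ r → (F.scheme T3UnitLawDensityEML.ℰp γ).β K * r ^ 2 ≤ Cth * Λ ^ 2 * (n : ℝ) ^ 5 → (T3UnitScaleTilt.gibbsK F T3UnitLawDensityEML.ℰp γ K).real {U | r ≤ f U - ∫ V, f V ∂(T3UnitScaleTilt.gibbsK F T3UnitLawDensityEML.ℰp γ K)} ≤ Cc * Real.exp (-(cc * (F.scheme T3UnitLawDensityEML.ℰp γ).β K * r ^ 2 / ((n : ℝ) ^ 2 * Λ ^ 2))) := by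
  sorry

/-! ## §2 Composition (sorry-free): curvature pinning + local exponential moment + √-bookkeeping ⟹ the LARGE-DEVIATION regime for ALL box
sizes; then large ∧ moderate(residual) ⟹ the mesoscopic residual of v1.1 (token-identical statement), so §4 applies verbatim. -/

set_option maxHeartbeats 1600000 in
open Classical in
/-- KERNEL (large deviations, every `n ≥ 1`): constants `C_th = 192·E₁·C² + 1`, `Cc = 1`, `cc = 1/(192·C²)`, `γ₁` of the moment stub. -/
theorem largeDeviation_of
    (hNP : ∃ C : ℝ, 0 < C ∧ ∀ (F : T3Family) (K n : ℕ) (x₀ : Site (F.P K) 0)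
      (f : GaugeField (F.P K) 0 (Matrix.specialUnitaryGroup (Fin 2) ℂ) → ℝ) (Λ : ℝ), 0 ≤ Λ → 1 ≤ n → 2 * n ≤ (F.P K).sitesPerDir 0 →
      GaugeField.GaugeInvariant f →
      (∀ U U' : GaugeField (F.P K) 0 (Matrix.specialUnitaryGroup (Fin 2) ℂ),
        (∀ b : PBond (F.P K) 0, (∀ k, (b.src k - x₀ k).val < n) → (∀ k, (b.tgt k - x₀ k).val < n) → U b = U' b) → f U = f U') →
      (∀ U U' : GaugeField (F.P K) 0 (Matrix.specialUnitaryGroup (Fin 2) ℂ),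
        |f U - f U'| ≤ Λ * Real.sqrt (∑ b : PBond (F.P K) 0, GaugeGroup.dist1 (U b * (U' b)⁻¹) ^ 2)) →
      ∀ U : GaugeField (F.P K) 0 (Matrix.specialUnitaryGroup (Fin 2) ℂ),
        |f U - f (fun _ => 1)| ≤ Λ * (C * (n : ℝ)) * Real.sqrt (∑ p ∈ Finset.univ.filter (fun p : Plaq (F.P K) 0 => p ∈ boxPlaqs (P := F.P K) (j := 0) (fun k => ((x₀ k).val : ℤ)) (fun k => ((x₀ k).val : ℤ) + ((n : ℤ) - 1))), GaugeGroup.dist1 (GaugeField.plaqHol U p) ^ 2))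
    (hLM : ∀ (L : ℕ), ∃ (E₁ : ℝ), 0 ≤ E₁ ∧ ∃ γ₁ : ℝ, 0 < γ₁ ∧ γ₁ ≤ 1 ∧
      ∀ (F : T3Family) (γ : ℝ), F.L = L → 0 < γ → γ ≤ γ₁ → ∀ (K n : ℕ) (x₀ : Site (F.P K) 0), 1 ≤ n → 2 * n ≤ (F.P K).sitesPerDir 0 →
        (Measurable fun U : GaugeField (F.P K) 0 (Matrix.specialUnitaryGroup (Fin 2) ℂ) => (∑ p ∈ Finset.univ.filter (fun p : Plaq (F.P K) 0 => p ∈ boxPlaqs (P := F.P K) (j := 0) (fun k => ((x₀ k).val : ℤ)) (fun k => ((x₀ k).val : ℤ) + ((n : ℤ) - 1))), GaugeGroup.dist1 (GaugeField.plaqHol U p) ^ 2)) ∧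
        (∀ U : GaugeField (F.P K) 0 (Matrix.specialUnitaryGroup (Fin 2) ℂ), 0 ≤ (∑ p ∈ Finset.univ.filter (fun p : Plaq (F.P K) 0 => p ∈ boxPlaqs (P := F.P K) (j := 0) (fun k => ((x₀ k).val : ℤ)) (fun k => ((x₀ k).val : ℤ) + ((n : ℤ) - 1))), GaugeGroup.dist1 (GaugeField.plaqHol U p) ^ 2) ∧ (∑ p ∈ Finset.univ.filter (fun p : Plaq (F.P K) 0 => p ∈ boxPlaqs (P := F.P K) (j := 0) (fun k => ((x₀ k).val : ℤ)) (fun k => ((x₀ k).val : ℤ) + ((n : ℤ) - 1))), GaugeGroup.dist1 (GaugeField.plaqHol U p) ^ 2) ≤ 12 * ((n : ℝ) + 1) ^ 3) ∧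
        ∫ U, Real.exp ((F.scheme ℰp γ).β K / 24 * (∑ p ∈ Finset.univ.filter (fun p : Plaq (F.P K) 0 => p ∈ boxPlaqs (P := F.P K) (j := 0) (fun k => ((x₀ k).val : ℤ)) (fun k => ((x₀ k).val : ℤ) + ((n : ℤ) - 1))), GaugeGroup.dist1 (GaugeField.plaqHol U p) ^ 2)) ∂(gibbsK F ℰp γ K) ≤ Real.exp (E₁ * (n : ℝ) ^ 3) ∧
        ∫ U, (∑ p ∈ Finset.univ.filter (fun p : Plaq (F.P K) 0 => p ∈ boxPlaqs (P := F.P K) (j := 0) (fun k => ((x₀ k).val : ℤ)) (fun k => ((x₀ k).val : ℤ) + ((n : ℤ) - 1))), GaugeGroup.dist1 (GaugeField.plaqHol U p) ^ 2) ∂(gibbsK F ℰp γ K) ≤ E₁ * (n : ℝ) ^ 3 / (F.scheme ℰp γ).β K)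
    (hB : ∀ (F : T3Family) (γ : ℝ), 0 < γ → ∀ (K : ℕ) (X g : GaugeField (F.P K) 0 (Matrix.specialUnitaryGroup (Fin 2) ℂ) → ℝ) (g₁ M t A m Xmax : ℝ),
      Measurable g → Measurable X → 0 ≤ M → 0 < t → 0 ≤ m → (∀ U, 0 ≤ X U) → (∀ U, X U ≤ Xmax) →
      (∀ U, |g U - g₁| ≤ M * Real.sqrt (X U)) →
      ∫ U, Real.exp (t * X U) ∂(gibbsK F ℰp γ K) ≤ Real.exp A →
      ∫ U, X U ∂(gibbsK F ℰp γ K) ≤ m →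
      ∀ r : ℝ, 0 < r → 4 * (M ^ 2 * m) ≤ r ^ 2 →
        (gibbsK F ℰp γ K).real {U | r ≤ g U - ∫ V, g V ∂(gibbsK F ℰp γ K)} ≤ Real.exp A * Real.exp (-(t * r ^ 2 / (4 * M ^ 2)))) :
        open Literature.MathematicalPhysics.QuantumFieldTheory.Balaban1983to89 Literature.MathematicalPhysics.QuantumFieldTheory.Balaban1983to89.T3ContinuumYM3Torus in ∀ (L : ℕ), ∃ (Cth : ℝ), 0 < Cth ∧ ∃ (Cc cc : ℝ), 0 ≤ Cc ∧ 0 < cc ∧ ∃ γ₁ : ℝ, 0 < γ₁ ∧ γ₁ ≤ 1 ∧ ∀ (F : T3Family) (γ : ℝ), F.L = L → 0 < γ → γ ≤ γ₁ → ∀ (K n : ℕ), 1 ≤ n → (n : ℝ) ≤ (F.scheme T3UnitLawDensityEML.ℰp γ).β K → 2 * n ≤ (F.P K).sitesPerDir 0 → ∀ (x₀ : Site (F.P K) 0) (f : GaugeField (F.P K) 0 (Matrix.specialUnitaryGroup (Fin 2) ℂ) → ℝ) (Λ : ℝ), 0 < Λ → Measurable f → GaugeField.GaugeInvariant f → (∀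 U U' : GaugeField (F.P K) 0 (Matrix.specialUnitaryGroup (Fin 2) ℂ), (∀ b : PBond (F.P K) 0, (∀ k, (b.src k - x₀ k).val < n) → (∀ k, (b.tgt k - x₀ k).val < n) → U b = U' b) → f U = f U') → (∀ U U' : GaugeField (F.P K) 0 (Matrix.specialUnitaryGroup (Fin 2) ℂ), |f U - f U'| ≤ Λ * Real.sqrt (∑ b : PBond (F.P K) 0, GaugeGroup.dist1 (U b * (U' b)⁻¹) ^ 2)) → ∀ r : ℝ, 0 ≤ r → Cth * Λ ^ 2 * (n : ℝ) ^ 5 ≤ (F.scheme T3UnitLawDensityEML.ℰp γ).β K * r ^ 2 → (T3UnitScaleTilt.gibbsK F T3UnitLawDensityEML.ℰp γ K).real {U | r ≤ f U - ∫ V, f V ∂(T3UnitScaleTilt.gibbsK F T3UnitLawDensityEML.ℰp γ K)} ≤ Cc * Real.exp (-(cc * (F.scheme T3UnitLawDensityEML.ℰp γ).β K * r ^ 2 / ((n : ℝ) ^ 2 * Λ ^ 2))) := by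
  obtain ⟨C, hC, HNP⟩ := hNP
  intro L
  obtain ⟨E₁, hE₁, γa, hγa, hγa1, HLM⟩ := hLM L
  refine ⟨192 * E₁ * C ^ 2 + 1, by positivity, 1, 1 / (192 * C ^ 2), zero_le_one, by positivity, γa, hγa, hγa1, ?_⟩
  intro F γ hFL hγ hγle K n hn1 hnβ h2n x₀ f Λ hΛ hfm hfG hloc hlip r hr hthr
  have hn1r : (1 : ℝ) ≤ (n : ℝ) := by exact_mod_cast hn1
  have hn0 : (0 : ℝ) < (n : ℝ) := by linarith
  have hβ : 0 < (F.scheme ℰp γ).β K := by linarith [hn1r.trans hnβ]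
  obtain ⟨hXm, hXrng, hXexp, hXmean⟩ := HLM F γ hFL hγ hγle K n x₀ hn1 h2n
  have hpin := HNP F K n x₀ f Λ hΛ.le hn1 h2n hfG hloc hlip
  -- the regime: 4·M²·m ≤ r², and r > 0
  have hreg : 4 * ((Λ * (C * (n : ℝ))) ^ 2 * (E₁ * (n : ℝ) ^ 3 / (F.scheme ℰp γ).β K)) ≤ r ^ 2 := by
    have h1 : (192 * E₁ * C ^ 2 + 1) * Λ ^ 2 * (n : ℝ) ^ 5 / (F.scheme ℰp γ).β K ≤ r ^ 2 := by
      rw [div_le_iff₀ hβ]; linarith [hthr]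
    have h2 : 4 * ((Λ * (C * (n : ℝ))) ^ 2 * (E₁ * (n : ℝ) ^ 3 / (F.scheme ℰp γ).β K))
        = (4 * E₁ * C ^ 2) * Λ ^ 2 * (n : ℝ) ^ 5 / (F.scheme ℰp γ).β K := by
      field_simp
    rw [h2]
    refine le_trans ?_ h1
    gcongr
    nlinarith [sq_nonneg C, hE₁]
  have hthr0 : 0 < (192 * E₁ * C ^ 2 + 1) * Λ ^ 2 * (n : ℝ) ^ 5 := by positivity
  have hr0 : 0 < r := by
    rcases lt_or_eq_of_le hr with h | h
    · exact h
    · exfalso; rw [← h] at hthr; simp at hthr; linarith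
  have key := hB F γ hγ K _ f (f (fun _ => 1)) (Λ * (C * (n : ℝ))) ((F.scheme ℰp γ).β K / 24) (E₁ * (n : ℝ) ^ 3)
    (E₁ * (n : ℝ) ^ 3 / (F.scheme ℰp γ).β K) (12 * ((n : ℝ) + 1) ^ 3) hfm hXm (by positivity) (by positivity) (by positivity)
    (fun U => (hXrng U).1) (fun U => (hXrng U).2) hpin hXexp hXmean r hr0 hreg
  refine key.trans ?_
  rw [← Real.exp_add, one_mul, Real.exp_le_exp]
  -- exponent comparison: E₁n³ − Q/96 ≤ −Q/192 with Q = β r²/(n²Λ²C²) ≥ (192E₁C²+1)·n³/C²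
  have hQ : (192 * E₁ * C ^ 2 + 1) * (n : ℝ) ^ 3 / C ^ 2
      ≤ (F.scheme ℰp γ).β K * r ^ 2 / ((n : ℝ) ^ 2 * Λ ^ 2 * C ^ 2) := by
    have e : (192 * E₁ * C ^ 2 + 1) * (n : ℝ) ^ 3 / C ^ 2
        = (192 * E₁ * C ^ 2 + 1) * Λ ^ 2 * (n : ℝ) ^ 5 / ((n : ℝ) ^ 2 * Λ ^ 2 * C ^ 2) := by
      field_simp
    rw [e]
    exact div_le_div_of_nonneg_right hthr (by positivity)
  have hE : E₁ * (n : ℝ) ^ 3 ≤ (F.scheme ℰp γ).β K * r ^ 2 / ((n : ℝ) ^ 2 * Λ ^ 2 * C ^ 2) / 192 := by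
    have e : (192 * E₁ * C ^ 2 + 1) * (n : ℝ) ^ 3 / C ^ 2 / 192 = E₁ * (n : ℝ) ^ 3 + (n : ℝ) ^ 3 / (192 * C ^ 2) := by
      field_simp
    have hpos : 0 ≤ (n : ℝ) ^ 3 / (192 * C ^ 2) := by positivity
    have := div_le_div_of_nonneg_right hQ (by norm_num : (0 : ℝ) ≤ 192)
    rw [e] at this
    linarith
  have e1 : (F.scheme ℰp γ).β K / 24 * r ^ 2 / (4 * (Λ * (C * (n : ℝ))) ^ 2)
      = (F.scheme ℰp γ).β K * r ^ 2 / ((n : ℝ) ^ 2 * Λ ^ 2 * C ^ 2) / 96 := by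
    field_simp
    ring
  have e2 : 1 / (192 * C ^ 2) * (F.scheme ℰp γ).β K * r ^ 2 / ((n : ℝ) ^ 2 * Λ ^ 2)
      = (F.scheme ℰp γ).β K * r ^ 2 / ((n : ℝ) ^ 2 * Λ ^ 2 * C ^ 2) / 192 := by
    field_simp
  rw [e1, e2]
  linarith

/-- The large-deviation regime from the registered stubs (sorries only inside the stubs). -/
theorem largeDeviation_of_stubs :
        open Literature.MathematicalPhysics.QuantumFieldTheory.Balaban1983to89 Literature.MathematicalPhysics.QuantumFieldTheory.Balaban1983to89.T3ContinuumYM3Torus in ∀ (L : ℕ), ∃ (Cth : ℝ), 0 < Cth ∧ ∃ (Cc cc : ℝ), 0 ≤ Cc ∧ 0 < cc ∧ ∃ γ₁ : ℝ, 0 < γ₁ ∧ γ₁ ≤ 1 ∧ ∀ (F : T3Family) (γ : ℝ), F.L = L → 0 < γ → γ ≤ γ₁ → ∀ (K n : ℕ), 1 ≤ n → (n : ℝ) ≤ (F.scheme T3UnitLawDensityEML.ℰp γ).β K → 2 * n ≤ (F.P K).sitesPerDir 0 → ∀ (x₀ : Site (F.P K) 0) (f : GaugeField (F.P K) 0 (Matrix.specialUnitaryGroup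 (Fin 2) ℂ) → ℝ) (Λ : ℝ), 0 < Λ → Measurable f → GaugeField.GaugeInvariant f → (∀ U U' : GaugeField (F.P K) 0 (Matrix.specialUnitaryGroup (Fin 2) ℂ), (∀ b : PBond (F.P K) 0, (∀ k, (b.src k - x₀ k).val < n) → (∀ k, (b.tgt k - x₀ k).val < n) → U b = U' b) → f U = f U') → (∀ U U' : GaugeField (F.P K) 0 (Matrix.specialUnitaryGroup (Fin 2) ℂ), |f U - f U'| ≤ Λ * Real.sqrt (∑ b : PBond (F.P K) 0, GaugeGroup.dist1 (U b * (U' b)⁻¹) ^ 2)) → ∀ r : ℝ, 0 ≤ r → Cth * Λ ^ 2 * (n : ℝ) ^ 5 ≤ (F.scheme T3UnitLawDensityEML.ℰp γ).β K * r ^ 2 → (T3UnitScaleTilt.gibbsK F T3UnitLawDensityEML.ℰp γ K).real {U | r ≤ f U - ∫ V, f V ∂(T3UnitScaleTilt.gibbsK F T3UnitLawDensityEML.ℰp γ K)} ≤ Cc * Real.exp (-(cc * (F.scheme T3UnitLawDensityEML.ℰp γ).β K * r ^ 2 / ((n : ℝ) ^ 2 * Λ ^ 2))) :=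
  largeDeviation_of stub_curvaturePinning stub_localBoxExpMoment stub_sqrtPinnedTail

/-- GLUE (regimes): large deviations (all `n`) `→` moderate-deviation residual (`17L³ < n`) `→` the v1.1 mesoscopic residual statement (token-identical
with LINE 23's `stub_mesoscopicBoxConcentration`): max/min of the constants, case split on `C_th·Λ²·n⁵ ≤ β_K r²`. -/
theorem mesoscopicResidual_of
    (hlarge :     open Literature.MathematicalPhysics.QuantumFieldTheory.Balaban1983to89 Literature.MathematicalPhysics.QuantumFieldTheory.Balaban1983to89.T3ContinuumYM3Torus in ∀ (L : ℕ), ∃ (Cth : ℝ), 0 < Cth ∧ ∃ (Cc cc : ℝ), 0 ≤ Cc ∧ 0 < cc ∧ ∃ γ₁ : ℝ, 0 < γ₁ ∧ γ₁ ≤ 1 ∧ ∀ (F : T3Family) (γ : ℝ), F.L = L → 0 < γ → γ ≤ γ₁ → ∀ (K n : ℕ), 1 ≤ n → (n : ℝ) ≤ (F.scheme T3UnitLawDensityEML.ℰp γ).β K → 2 * n ≤ (F.P K).sitesPerDir 0 → ∀ (x₀ : Site (F.P K) 0) (f : GaugeField (F.P K) 0 (Matrix.specialUnitaryGroup (Fin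 2) ℂ) → ℝ) (Λ : ℝ), 0 < Λ → Measurable f → GaugeField.GaugeInvariant f → (∀ U U' : GaugeField (F.P K) 0 (Matrix.specialUnitaryGroup (Fin 2) ℂ), (∀ b : PBond (F.P K) 0, (∀ k, (b.src k - x₀ k).val < n) → (∀ k, (b.tgt k - x₀ k).val < n) → U b = U' b) → f U = f U') → (∀ U U' : GaugeField (F.P K) 0 (Matrix.specialUnitaryGroup (Fin 2) ℂ), |f U - f U'| ≤ Λ * Real.sqrt (∑ b : PBond (F.P K) 0, GaugeGroup.dist1 (U b * (U' b)⁻¹) ^ 2)) → ∀ r : ℝ, 0 ≤ r → Cth * Λ ^ 2 * (n : ℝ) ^ 5 ≤ (F.scheme T3UnitLawDensityEML.ℰp γ).β K * r ^ 2 → (T3UnitScaleTilt.gibbsK F T3UnitLawDensityEML.ℰp γ K).real {U | r ≤ f U - ∫ V, f V ∂(T3UnitScaleTilt.gibbsK F T3UnitLawDensityEML.ℰp γ K)} ≤ Cc * Real.exp (-(cc * (F.scheme T3UnitLawDensityEML.ℰp γ).β K * r ^ 2 / ((n : ℝ) ^ 2 * Λ ^ 2))))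
    (hmod :     open Literature.MathematicalPhysics.QuantumFieldTheory.Balaban1983to89 Literature.MathematicalPhysics.QuantumFieldTheory.Balaban1983to89.T3ContinuumYM3Torus in ∀ (L : ℕ) (Cth : ℝ), 0 < Cth → ∃ (Cc cc : ℝ), 0 ≤ Cc ∧ 0 < cc ∧ ∃ γ₁ : ℝ, 0 < γ₁ ∧ γ₁ ≤ 1 ∧ ∀ (F : T3Family) (γ : ℝ), F.L = L → 0 < γ → γ ≤ γ₁ → ∀ (K n : ℕ), 1 ≤ n → (n : ℝ) ≤ (F.scheme T3UnitLawDensityEML.ℰp γ).β K → 2 * n ≤ (F.P K).sitesPerDir 0 → 17 * L ^ 3 < n → ∀ (x₀ : Site (F.P K) 0) (f : GaugeField (F.P K) 0 (Matrix.specialUnitaryGroup (Fin 2) ℂ) → ℝ) (Λ : ℝ), 0 < Λ → Measurable f → GaugeField.GaugeInvariant f → (∀ U U' : GaugeField (F.P K) 0 (Matrix.specialUnitaryGroup (Fin 2) ℂ), (∀ b : PBond (F.P K) 0, (∀ k, (b.src k - x₀ k).val < n) → (∀ k, (b.tgt k - x₀ k).val < n) → U b = U' b) → f U = f U') → (∀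 U U' : GaugeField (F.P K) 0 (Matrix.specialUnitaryGroup (Fin 2) ℂ), |f U - f U'| ≤ Λ * Real.sqrt (∑ b : PBond (F.P K) 0, GaugeGroup.dist1 (U b * (U' b)⁻¹) ^ 2)) → ∀ r : ℝ, 0 ≤ r → (F.scheme T3UnitLawDensityEML.ℰp γ).β K * r ^ 2 ≤ Cth * Λ ^ 2 * (n : ℝ) ^ 5 → (T3UnitScaleTilt.gibbsK F T3UnitLawDensityEML.ℰp γ K).real {U | r ≤ f U - ∫ V, f V ∂(T3UnitScaleTilt.gibbsK F T3UnitLawDensityEML.ℰp γ K)} ≤ Cc * Real.exp (-(cc * (F.scheme T3UnitLawDensityEML.ℰp γ).β K * r ^ 2 / ((n : ℝ) ^ 2 * Λ ^ 2)))) :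
        open Literature.MathematicalPhysics.QuantumFieldTheory.Balaban1983to89 Literature.MathematicalPhysics.QuantumFieldTheory.Balaban1983to89.T3ContinuumYM3Torus in ∀ (L : ℕ), ∃ (Cc cc : ℝ), 0 ≤ Cc ∧ 0 < cc ∧ ∃ γ₁ : ℝ, 0 < γ₁ ∧ γ₁ ≤ 1 ∧ ∀ (F : T3Family) (γ : ℝ), F.L = L → 0 < γ → γ ≤ γ₁ → ∀ (K n : ℕ), 1 ≤ n → (n : ℝ) ≤ (F.scheme T3UnitLawDensityEML.ℰp γ).β K → 2 * n ≤ (F.P K).sitesPerDir 0 → 17 * L ^ 3 < n → ∀ (x₀ : Site (F.P K) 0) (f : GaugeField (F.P K) 0 (Matrix.specialUnitaryGroup (Fin 2) ℂ) → ℝ) (Λ : ℝ), 0 < Λ → Measurable f → GaugeField.GaugeInvariant f → (∀ U U' : GaugeField (F.P K) 0 (Matrix.specialUnitaryGroup (Fin 2) ℂ), (∀ b : PBond (F.P K) 0, (∀ k, (b.src k - x₀ k).val < n) → (∀ k, (b.tgt k - x₀ k).val < n) → U b = U' b) → f U = f U') → (∀ U U' : GaugeField (F.P K) 0 (Matrix.specialUnitaryGroup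 (Fin 2) ℂ), |f U - f U'| ≤ Λ * Real.sqrt (∑ b : PBond (F.P K) 0, GaugeGroup.dist1 (U b * (U' b)⁻¹) ^ 2)) → ∀ r : ℝ, 0 ≤ r → (T3UnitScaleTilt.gibbsK F T3UnitLawDensityEML.ℰp γ K).real {U | r ≤ f U - ∫ V, f V ∂(T3UnitScaleTilt.gibbsK F T3UnitLawDensityEML.ℰp γ K)} ≤ Cc * Real.exp (-(cc * (F.scheme T3UnitLawDensityEML.ℰp γ).β K * r ^ 2 / ((n : ℝ) ^ 2 * Λ ^ 2))) := by
  intro L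
  obtain ⟨Cth, hCth, Cc₁, cc₁, hCc₁, hcc₁, γa, hγa, hγa1, H1⟩ := hlarge L
  obtain ⟨Cc₂, cc₂, hCc₂, hcc₂, γb, hγb, hγb1, H2⟩ := hmod L Cth hCth
  refine ⟨max Cc₁ Cc₂, min cc₁ cc₂, le_max_of_le_left hCc₁, lt_min hcc₁ hcc₂, min γa γb, lt_min hγa hγb,
    (min_le_left _ _).trans hγa1, ?_⟩
  intro F γ hFL hγ hγle K n hn1 hnβ h2n hnL x₀ f Λ hΛ hfm hfG hloc hlip r hr
  have hn1r : (1 : ℝ) ≤ (n : ℝ) := by exact_mod_cast hn1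
  have hβ0 : (0 : ℝ) ≤ (F.scheme ℰp γ).β K := by linarith [hn1r.trans hnβ]
  have hQ0 : 0 ≤ (F.scheme ℰp γ).β K * r ^ 2 / ((n : ℝ) ^ 2 * Λ ^ 2) := by positivity
  have hmono : ∀ (C c : ℝ), C ≤ max Cc₁ Cc₂ → min cc₁ cc₂ ≤ c →
      C * Real.exp (-(c * (F.scheme ℰp γ).β K * r ^ 2 / ((n : ℝ) ^ 2 * Λ ^ 2)))
        ≤ max Cc₁ Cc₂ * Real.exp (-(min cc₁ cc₂ * (F.scheme ℰp γ).β K * r ^ 2 / ((n : ℝ) ^ 2 * Λ ^ 2))) := by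
    intro C c hC hc
    refine mul_le_mul hC ?_ (Real.exp_pos _).le ((hCc₁.trans (le_max_left _ _)))
    rw [Real.exp_le_exp, neg_le_neg_iff]
    have e1 : min cc₁ cc₂ * (F.scheme ℰp γ).β K * r ^ 2 / ((n : ℝ) ^ 2 * Λ ^ 2)
        = min cc₁ cc₂ * ((F.scheme ℰp γ).β K * r ^ 2 / ((n : ℝ) ^ 2 * Λ ^ 2)) := by ring
    have e2 : c * (F.scheme ℰp γ).β K * r ^ 2 / ((n : ℝ) ^ 2 * Λ ^ 2)
        = c * ((F.scheme ℰp γ).β K * r ^ 2 / ((n : ℝ) ^ 2 * Λ ^ 2)) := by ring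
    rw [e1, e2]
    exact mul_le_mul_of_nonneg_right hc hQ0
  by_cases hreg : Cth * Λ ^ 2 * (n : ℝ) ^ 5 ≤ (F.scheme ℰp γ).β K * r ^ 2
  · exact (H1 F γ hFL hγ (hγle.trans (min_le_left _ _)) K n hn1 hnβ h2n x₀ f Λ hΛ hfm hfG hloc hlip r hr hreg).trans
      (hmono Cc₁ cc₁ (le_max_left _ _) (min_le_left _ _))
  · exact (H2 F γ hFL hγ (hγle.trans (min_le_right _ _)) K n hn1 hnβ h2n hnL x₀ f Λ hΛ hfm hfG hloc hlip r hr (not_le.mp hreg).le).trans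
      (hmono Cc₂ cc₂ (le_max_right _ _) (min_le_right _ _))

/-- The v1.1 mesoscopic residual statement, now DERIVED from the three v2 stubs + the moderate-deviation residual. -/
theorem mesoscopicResidual_of_stubs :
        open Literature.MathematicalPhysics.QuantumFieldTheory.Balaban1983to89 Literature.MathematicalPhysics.QuantumFieldTheory.Balaban1983to89.T3ContinuumYM3Torus in ∀ (L : ℕ), ∃ (Cc cc : ℝ), 0 ≤ Cc ∧ 0 < cc ∧ ∃ γ₁ : ℝ, 0 < γ₁ ∧ γ₁ ≤ 1 ∧ ∀ (F : T3Family) (γ : ℝ), F.L = L → 0 < γ → γ ≤ γ₁ → ∀ (K n : ℕ), 1 ≤ n → (n : ℝ) ≤ (F.scheme T3UnitLawDensityEML.ℰp γ).β K → 2 * n ≤ (F.P K).sitesPerDir 0 → 17 * L ^ 3 < n → ∀ (x₀ : Site (F.P K) 0) (f : GaugeField (F.P K) 0 (Matrix.specialUnitaryGroup (Fin 2) ℂ) → ℝ) (Λ : ℝ), 0 < Λ → Measurable f → GaugeField.GaugeInvariant f → (∀ U U' : GaugeField (F.P K) 0 (Matrix.specialUnitaryGroup (Fin 2) ℂ), (∀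 b : PBond (F.P K) 0, (∀ k, (b.src k - x₀ k).val < n) → (∀ k, (b.tgt k - x₀ k).val < n) → U b = U' b) → f U = f U') → (∀ U U' : GaugeField (F.P K) 0 (Matrix.specialUnitaryGroup (Fin 2) ℂ), |f U - f U'| ≤ Λ * Real.sqrt (∑ b : PBond (F.P K) 0, GaugeGroup.dist1 (U b * (U' b)⁻¹) ^ 2)) → ∀ r : ℝ, 0 ≤ r → (T3UnitScaleTilt.gibbsK F T3UnitLawDensityEML.ℰp γ K).real {U | r ≤ f U - ∫ V, f V ∂(T3UnitScaleTilt.gibbsK F T3UnitLawDensityEML.ℰp γ K)} ≤ Cc * Real.exp (-(cc * (F.scheme T3UnitLawDensityEML.ℰp γ).β K * r ^ 2 / ((n : ℝ) ^ 2 * Λ ^ 2))) :=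
  mesoscopicResidual_of largeDeviation_of_stubs stub_moderateDeviationResidual

/-! ## §3 Composition (sorry-free): the tree's bounded-box theorem + the derived residual ⟹ `MesoscopicConcentrationL` BY NAME -/

/-- GLUE: bounded-box rung `→` residual `→` the TEXT of `MesoscopicConcentrationL` (verbatim signature of stmt-QuantumFields-23532; max/min of the two
constant packages, monotonicity of `x ↦ Cc·e^{−cc·x}`; = LINE 23/29 §4 and ✓px10 `…OfMesoscopicBox.mesoscopicConcentrationL_of`, kept here so the
file does not depend on a module landed minutes ago).  The crux BY NAME is concluded only by `MesoscopicConcentrationL_of_stubs` below. -/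
theorem mesoscopicConcentrationL_of
    (hbdd :
    open Literature.MathematicalPhysics.QuantumFieldTheory.Balaban1983to89 Literature.MathematicalPhysics.QuantumFieldTheory.Balaban1983to89.T3ContinuumYM3Torus in ∀ (L : ℕ), ∃ (Cc cc : ℝ), 0 ≤ Cc ∧ 0 < cc ∧ ∃ γ₁ : ℝ, 0 < γ₁ ∧ γ₁ ≤ 1 ∧ ∀ (F : T3Family) (γ : ℝ), F.L = L → 0 < γ → γ ≤ γ₁ → ∀ (K n : ℕ), 1 ≤ n → (n : ℝ) ≤ (F.scheme T3UnitLawDensityEML.ℰp γ).β K → 2 * n ≤ (F.P K).sitesPerDir 0 → n ≤ 17 * L ^ 3 → ∀ (x₀ : Site (F.P K) 0) (f : GaugeField (F.P K) 0 (Matrix.specialUnitaryGroup (Fin 2) ℂ) → ℝ) (Λ : ℝ), 0 < Λ → Measurable f → GaugeField.GaugeInvariant f → (∀ U U' : GaugeField (F.P K) 0 (Matrix.specialUnitaryGroup (Fin 2) ℂ), (∀ b : PBond (F.P K) 0, (∀ k, (b.src k - x₀ k).val < n) → (∀ k, (b.tgt k - x₀ k).val < n) → U b = U' b) → f U = f U')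 → (∀ U U' : GaugeField (F.P K) 0 (Matrix.specialUnitaryGroup (Fin 2) ℂ), |f U - f U'| ≤ Λ * Real.sqrt (∑ b : PBond (F.P K) 0, GaugeGroup.dist1 (U b * (U' b)⁻¹) ^ 2)) → ∀ r : ℝ, 0 ≤ r → (T3UnitScaleTilt.gibbsK F T3UnitLawDensityEML.ℰp γ K).real {U | r ≤ f U - ∫ V, f V ∂(T3UnitScaleTilt.gibbsK F T3UnitLawDensityEML.ℰp γ K)} ≤ Cc * Real.exp (-(cc * (F.scheme T3UnitLawDensityEML.ℰp γ).β K * r ^ 2 / ((n : ℝ) ^ 2 * Λ ^ 2))))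
    (hR : open Literature.MathematicalPhysics.QuantumFieldTheory.Balaban1983to89 Literature.MathematicalPhysics.QuantumFieldTheory.Balaban1983to89.T3ContinuumYM3Torus in ∀ (L : ℕ), ∃ (Cc cc : ℝ), 0 ≤ Cc ∧ 0 < cc ∧ ∃ γ₁ : ℝ, 0 < γ₁ ∧ γ₁ ≤ 1 ∧ ∀ (F : T3Family) (γ : ℝ), F.L = L → 0 < γ → γ ≤ γ₁ → ∀ (K n : ℕ), 1 ≤ n → (n : ℝ) ≤ (F.scheme T3UnitLawDensityEML.ℰp γ).β K → 2 * n ≤ (F.P K).sitesPerDir 0 → 17 * L ^ 3 < n → ∀ (x₀ : Site (F.P K) 0) (f : GaugeField (F.P K) 0 (Matrix.specialUnitaryGroup (Fin 2) ℂ) → ℝ) (Λ : ℝ), 0 < Λ → Measurable f → GaugeField.GaugeInvariant f → (∀ U U' : GaugeField (F.P K) 0 (Matrix.specialUnitaryGroup (Fin 2) ℂ), (∀ b : PBond (F.P K) 0, (∀ k, (b.src k - x₀ k).val < n) → (∀ k, (b.tgt k - x₀ k).val < n) → U b = U' b) → f U = f U') → (∀ U U' : GaugeField (F.P K) 0 (Matrix.specialUnitaryGroup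 (Fin 2) ℂ), |f U - f U'| ≤ Λ * Real.sqrt (∑ b : PBond (F.P K) 0, GaugeGroup.dist1 (U b * (U' b)⁻¹) ^ 2)) → ∀ r : ℝ, 0 ≤ r → (T3UnitScaleTilt.gibbsK F T3UnitLawDensityEML.ℰp γ K).real {U | r ≤ f U - ∫ V, f V ∂(T3UnitScaleTilt.gibbsK F T3UnitLawDensityEML.ℰp γ K)} ≤ Cc * Real.exp (-(cc * (F.scheme T3UnitLawDensityEML.ℰp γ).β K * r ^ 2 / ((n : ℝ) ^ 2 * Λ ^ 2)))) :
    open Literature.MathematicalPhysics.QuantumFieldTheory.Balaban1983to89 Literature.MathematicalPhysics.QuantumFieldTheory.Balaban1983to89.T3ContinuumYM3Torus in ∀ (L : ℕ), ∃ (Cc cc : ℝ), 0 ≤ Cc ∧ 0 < cc ∧ ∃ γ₁ : ℝ, 0 < γ₁ ∧ γ₁ ≤ 1 ∧ ∀ (F : T3Family) (γ : ℝ), F.L = L → 0 < γ → γ ≤ γ₁ → ∀ (K n : ℕ), 1 ≤ n → (n : ℝ) ≤ (F.scheme T3UnitLawDensityEML.ℰp γ).β K → 2 * n ≤ (F.P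 K).sitesPerDir 0 → ∀ (x₀ : Site (F.P K) 0) (f : GaugeField (F.P K) 0 (Matrix.specialUnitaryGroup (Fin 2) ℂ) → ℝ) (Λ : ℝ), 0 < Λ → Measurable f → GaugeField.GaugeInvariant f → (∀ U U' : GaugeField (F.P K) 0 (Matrix.specialUnitaryGroup (Fin 2) ℂ), (∀ b : PBond (F.P K) 0, (∀ k, (b.src k - x₀ k).val < n) → (∀ k, (b.tgt k - x₀ k).val < n) → U b = U' b) → f U = f U') → (∀ U U' : GaugeField (F.P K) 0 (Matrix.specialUnitaryGroup (Fin 2) ℂ), |f U - f U'| ≤ Λ * Real.sqrt (∑ b : PBond (F.P K) 0, GaugeGroup.dist1 (U b * (U' b)⁻¹) ^ 2)) → ∀ r : ℝ, 0 ≤ r → (T3UnitScaleTilt.gibbsK F T3UnitLawDensityEML.ℰp γ K).real {U | r ≤ f U - ∫ V, f V ∂(T3UnitScaleTilt.gibbsK F T3UnitLawDensityEML.ℰp γ K)} ≤ Cc * Real.exp (-(cc * (F.scheme T3UnitLawDensityEML.ℰp γ).β K * r ^ 2 / ((n : ℝ) ^ 2 * Λ ^ 2))) := by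
  intro L
  obtain ⟨Cc₁, cc₁, hCc₁, hcc₁, γa, hγa, hγa1, H1⟩ := hbdd L
  obtain ⟨Cc₂, cc₂, hCc₂, hcc₂, γb, hγb, hγb1, H2⟩ := hR L
  refine ⟨max Cc₁ Cc₂, min cc₁ cc₂, le_max_of_le_left hCc₁, lt_min hcc₁ hcc₂, min γa γb, lt_min hγa hγb,
    (min_le_left _ _).trans hγa1, ?_⟩
  intro F γ hFL hγ hγle K n hn1 hnβ h2n x₀ f Λ hΛ hfm hfG hloc hlip r hr
  have hn1r : (1 : ℝ) ≤ (n : ℝ) := by exact_mod_cast hn1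
  have hβ0 : (0 : ℝ) ≤ (F.scheme ℰp γ).β K := by linarith [hn1r.trans hnβ]
  have hQ0 : 0 ≤ (F.scheme ℰp γ).β K * r ^ 2 / ((n : ℝ) ^ 2 * Λ ^ 2) := by positivity
  -- monotonicity in the constants
  have hmono : ∀ (C c : ℝ), C ≤ max Cc₁ Cc₂ → min cc₁ cc₂ ≤ c →
      C * Real.exp (-(c * (F.scheme ℰp γ).β K * r ^ 2 / ((n : ℝ) ^ 2 * Λ ^ 2)))
        ≤ max Cc₁ Cc₂ * Real.exp (-(min cc₁ cc₂ * (F.scheme ℰp γ).β K * r ^ 2 / ((n : ℝ) ^ 2 * Λ ^ 2))) := by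
    intro C c hC hc
    refine mul_le_mul hC ?_ (Real.exp_pos _).le ((hCc₁.trans (le_max_left _ _)))
    rw [Real.exp_le_exp, neg_le_neg_iff]
    have e1 : min cc₁ cc₂ * (F.scheme ℰp γ).β K * r ^ 2 / ((n : ℝ) ^ 2 * Λ ^ 2)
        = min cc₁ cc₂ * ((F.scheme ℰp γ).β K * r ^ 2 / ((n : ℝ) ^ 2 * Λ ^ 2)) := by ring
    have e2 : c * (F.scheme ℰp γ).β K * r ^ 2 / ((n : ℝ) ^ 2 * Λ ^ 2)
        = c * ((F.scheme ℰp γ).β K * r ^ 2 / ((n : ℝ) ^ 2 * Λ ^ 2)) := by ring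
    rw [e1, e2]
    exact mul_le_mul_of_nonneg_right hc hQ0
  by_cases hnL : n ≤ 17 * L ^ 3
  · exact (H1 F γ hFL hγ (hγle.trans (min_le_left _ _)) K n hn1 hnβ h2n hnL x₀ f Λ hΛ hfm hfG hloc hlip r hr).trans
      (hmono Cc₁ cc₁ (le_max_left _ _) (min_le_left _ _))
  · exact (H2 F γ hFL hγ (hγle.trans (min_le_right _ _)) K n hn1 hnβ h2n (not_le.mp hnL) x₀ f Λ hΛ hfm hfG hloc hlip r hr).trans
      (hmono Cc₂ cc₂ (le_max_right _ _) (min_le_right _ _))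

/-- **LINE 30's CONCLUSION BY NAME.**  ✓`PoincareLipschitzStubBoundedBoxConcentration.stub_boundedBoxConcentration` (tree theorem, bounded boxes) + the four
stubs (curvature pinning + local moment + √-bookkeeping ⟹ large deviations; the moderate-deviation residual) ⟹ `PoincareLipschitz.MesoscopicConcentrationL`
(stmt-QuantumFields-23532).  NOT closed: every stub is a `sorry`. -/
theorem MesoscopicConcentrationL_of_stubs :
    Summit.QuantumFields.YangMills.Theses.PoincareLipschitz.MesoscopicConcentrationL := by
  have h := mesoscopicConcentrationL_of
    Summit.QuantumFields.YangMills.Theorems.PoincareLipschitzStubBoundedBoxConcentration.stub_boundedBoxConcentration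
    mesoscopicResidual_of_stubs
  exact h

end Summit.QuantumFields.YangMills.Cruxes.HistoryTailL.CurvaturePoincare
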